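import Summits.QuantumFields.BalabanUV.Beta.GAN24.T2DriftEvenEnd
import Summits.QuantumFields.BalabanUV.Beta.GAN24.CombAffineUnrollProjected

/-!
# `BalabanUV.Beta.GAN24.CombT2DriftEvenEnd` — binder row G-an2-4 ∕ (CONV-C), TRANSFER-III: **LINK L8c′ OF THE (α-0) CHAIN AT ROW D1's LITERAL OF RECORD (III′) —
# THE «T2Drift^ε» SOCKET FOR THE COMB-CHART `T₂` TOWER: under «T2Shape^ε» (`hy`), the two rows of the RELATIVE source `b′^{rel,ε}` (`hb`, `hZ`) and its one-step drift
# row (`hbd`), the `ε`-member `y_n = ½ • (T̃′_n + ε • P T̃′_n)` of the comb-chart unit tower has road W3's «T2Drift»: ONE-STEP geometric rate and CAUCHY form at one rate**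
# — MY (E) socket `T2DriftEvenEnd.rate_halfMember_three_of_relSource_rows` (there: (E) = `T2RecAt ρ`, `Ĝ_j = coDressKBmAt ρ Lc (KInvStep Lc j)`) RE-RUN at the sym ∕ comb
# slot data `(GcombSh Lc, SpureCombOf tabs …, tabs.M, tabs.vh₂S, tabs.mixFF)`; EVERY engine used is chart-free (road W3's UNDRESSED transport `KInvStep`: leaf-01's
# `AffineUnroll.diff_eq_transport_add_sum`, MY `TransportRows.rate_three_of_rows_F3b`, road-P2's `T2DevConservationDriftRows.zfreeSym_forcing ∕ exists_forcing_rate`,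
# MY `T2DriftEvenEnd` §1 (`zfreeSym_succ_sub`, `pinConst_three`), MY `KSlotAssembly.convCKWall_holds`); the TWO instance inputs are re-typed in §1: the `ε`-member's
# one-step law (leaf-01 g72's `HalfMemberSlavedDivergence.halfMember_succ_eq` at the comb data, through MY `CombAffineUnrollProjected.sgnK_trK_lin4_unitK_GcombSh`)
# and the comb tower's joint `Lc`-covariance (an2's `RecursiveWSlot.T2RecOf_translate` with the record's letters)
# (OWNER of row G-an2-4, unit `b2b-balaban-gan24-p1` gen 46; no existing file touched)

NOT IN PRINT; OUR BOOKKEEPING ([folklore] composition BY NAME; the §2 statement is the (E) socket's with `(coDressKBmAt ρ (KInvStep ·), SpureRecAt ρ, M1At ρ cΛ, vh₂S,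
mixFFAt ρ) ↦ (GcombSh Lc ·, SpureCombOf tabs, tabs.M, tabs.vh₂S, tabs.mixFF)`, the root binder `hr` ↦ the record `tabs`, the border's (TB) letter `hBt` ↦ `tabs.hBt`
(232 token substitutions, whitespace-robust, then proof-read); 0 `def`, 0 cited fact, 0 `def … : Prop`, 0 sorry).
HONEST FRAMING (cell contract, verbatim): «discharging `BetaPertH` makes Bałaban's UV stability UNCONDITIONAL — a real constructive-QFT result; it is NOT the continuum limit
and NOT the Clay problem.»  HONEST DEPENDENCY (verbatim): «continuum YM on T⁴ ⇐ BetaPertH ∧ nine spine estimates (0/9 proved); BetaPertH ⇐ (D1) ∧ (D4) ∧ CAP+tail;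
G-an2-4 gates asym, D1 and NE2/3/4.»

WHY (OWNER link table R-gan24p1-g46-2 row «L8b–L9»; L8c′'s (E) author is the OWNER, gen 35).  With `CombT2ShapeEvenEnd` (L8c) and THIS file the comb-chart `T₂` tower's
even ∕ odd members have BOTH of road W3's ENDs («T2Shape», «T2Drift») socketed on the RELATIVE source's rows ALONE — the (III′) state of the (E) chain after gen 35
(`ALPHA0-STATUS` L8c ∕ L8c′).  The rows `hb ∕ hZ ∕ hbd` at (III′) are the campaign's content (cells with `Ψ̂_S`; an1's sym border ∕ mixed letters) and are NOT touched.

CONTENT (`d + 1 = 4` for §2; §1 generic `d`, `Lc ≥ 1`).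
* §1 `halfMember_comb_succ_eq` — the `ε`-member's ONE-STEP LAW `y_{j+1} = 𝒜^{G′}_j y_j + ½ • (b̃′_j + ε • P b̃′_j)` for the comb-chart tower, any sym record with off-diagonal border
  (road-P2's slot-generic (F1) step `T2RecOfUnitSplit.unitS₂_T2RecOf_succ_eq_lin4_add` + `step_data_of_letters` + `bdd₄_unitS₂_T2RecOf_of_letters` with the record's letters;
  the parity commutes with the dressed comb step by `sgnK_trK_lin4_unitK_GcombSh`); `unitS₂_T2RecOf_comb_translate` — the comb-chart unit tower is jointly `Lc`-covariant
  (an2's `T2RecOf_translate` with `shiftK_GcombSh`, `SpureCombOf_translate`, `tabs.hMt ∕ hBt ∕ hmixt`; leaf-01's `unitS₂_translate`).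
* §2 **`rate_halfMember_comb_three_of_relSource_rows`** — THE DRIFT SOCKET (`2 ≤ Lc`, EXACT pin `cE₂ = +Lc⁸`, any `tabs : SymTables 3 Lc` with off-diagonal `LocStencil₂`
  border (the (E) socket's `hB hδB` binders DROPPED — the record carries the class), every `ε`, every `cE cVH cΛ cB Tc`): `hy` ∧ `hb` ∧ `hZ` ∧ `hbd` ⟹ `∃ c ϑ δ, 0 ≤ c ∧ 0 < ϑ < 1 ∧ 0 < δ ∧` one-step rate `LocStencil₂ (y_{n+1} − y_n) (c·ϑ^n) δ`
  `∧` Cauchy form `LocStencil₂ (y_{k+j} − y_k) (c·(1−ϑ)⁻¹·ϑ^k) δ`.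
WHAT THIS IS NOT.  No source row proved; not `hcell ∕ hcelld` (L8b′), not the capstone L9, not one W-slot row unconditionally; NEVER «G-an2-4 closed» as (CONV-C); NOT D1,
NOT `BetaPertH`, NOT continuum, NOT Clay.  2026-08-25.
-/

noncomputable section

open Finset
open scoped BigOperators
open Literature.MathematicalPhysics.QuantumFieldTheory
open Literature.MathematicalPhysics.QuantumFieldTheory.Balaban1983to89
open Literature.MathematicalPhysics.QuantumFieldTheory.Balaban1983to89.Beta
open ExpKernelCalculus (MKer shiftK Decays VertexFamily₂)
open OneStepResolventKernel (Fib LocStencil)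
open OneStepKernelFamily (KInvStep)
open SecondOrderResponse (W2SymOfK)
open BalabanCompositeJets (LocStencil₂ LocStencil₂.nonneg LocStencil₂.mono)
open BalabanStepJetsSucc (mmRead)
open BalabanStepW2 (K3OfK M2Of)
open Summit.QuantumFields.BalabanUV.Beta.TameKernelCalculus (trK)
open Summit.QuantumFields.BalabanUV.Beta.BorderedHessian (sgnK)
open Summit.QuantumFields.BalabanUV.Beta.HessKerDressedUnits (unitK unitS decays_unitK)
open Summit.QuantumFields.BalabanUV.Beta.SecondOrderUnits (unitM unitS₂ unitM₂)
open Summit.QuantumFields.BalabanUV.Beta.SpineRooted (T2RecOf T2RecOf_translate)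
open Summit.QuantumFields.BalabanUV.Beta.SymmetrisedStepJets (SymTables)
open Summit.QuantumFields.BalabanUV.Beta.CombChartStepJets (GcombSh decays_GcombSh shiftK_GcombSh SpureCombOf locStencil_SpureCombOf SpureCombOf_translate)
open Summit.QuantumFields.BalabanUV.Beta.GAN24.CombesThomas (sfStep smStep UnitDecayK CauchyDecayK)
open Summit.QuantumFields.BalabanUV.Beta.GAN24.T2RecursionAffine (lin4)
open Summit.QuantumFields.BalabanUV.Beta.GAN24.AffineUnroll (transport diff_eq_transport_add_sum)
open Summit.QuantumFields.BalabanUV.Beta.GAN24.BiStencilZeroMode (Tab zmode)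
open Summit.QuantumFields.BalabanUV.Beta.GAN24.Push4Iter (BiTab)
open Summit.QuantumFields.BalabanUV.Beta.GAN24.KSlotAssembly (convCKWall_holds)
open Summit.QuantumFields.BalabanUV.Beta.GAN24.TransportRows (rate_three_of_rows_F3b)
open Summit.QuantumFields.BalabanUV.Beta.GAN24.WSlotT2OfPieces (cauchy_of_rate locStencil₂_add)
open Summit.QuantumFields.BalabanUV.Beta.GAN24.WSlotForcingZeroMode (locStencil₂_sub)
open Summit.QuantumFields.BalabanUV.Beta.GAN24.WSlotForcingZeroModeW3 (add_translate_pi sub_translate_pi)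
open Summit.QuantumFields.BalabanUV.Beta.GAN24.WSlotFirstDiff (zmode_add zmode_sub)
open Summit.QuantumFields.BalabanUV.Beta.GAN24.Lin4ZeroMode (lin4_translate shiftK_unitKInvStep zmode_lin4_step locStencil₂_lin4)
open Summit.QuantumFields.BalabanUV.Beta.GAN24.T2UnitSplitLevels (bdd₄_zero bdd₄_add bdd₄_sub lin4_add_of_bdd₄)
open Summit.QuantumFields.BalabanUV.Beta.GAN24.T2UnitSplitShapes (bdd₄_of_locStencil₂)
open Summit.QuantumFields.BalabanUV.Beta.GAN24.T2UnitSplitFrom (lin4_bdd₄ lin4_add_bdd₄)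
open Summit.QuantumFields.BalabanUV.Beta.GAN24.Lin4Additive (lin4_smul)
open Summit.QuantumFields.BalabanUV.Beta.GAN24.T2RecOfUnitSplit (unitS₂_T2RecOf_succ_eq_lin4_add step_data_of_letters bdd₄_unitS₂_T2RecOf_of_letters)
open Summit.QuantumFields.BalabanUV.Beta.GAN24.T2SlotCovariance (unitS₂_translate)
open Summit.QuantumFields.BalabanUV.Beta.GAN24.T2DevConservationDriftRows (zfreeSym_add zfreeSym_sub zfreeSym_forcing exists_forcing_rate)
open Summit.QuantumFields.BalabanUV.Beta.GAN24.AffineUnrollProjected (bdd₄_parity parity_add bdd₄_smul)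
open Summit.QuantumFields.BalabanUV.Beta.GAN24.T2ShapeEvenEnd (translate_halfTable)
open Summit.QuantumFields.BalabanUV.Beta.GAN24.T2DriftEvenEnd (zsym_lin4_step_eq zfreeSym_lin4_sub_self zfreeSym_succ_sub pinConst_three)
open Summit.QuantumFields.BalabanUV.Beta.GAN24.CombAffineUnrollProjected (sgnK_trK_lin4_unitK_GcombSh)

namespace Summit.QuantumFields.BalabanUV.Beta.GAN24.CombT2DriftEvenEnd

/-! ## §1 The two comb-chart inputs: the `ε`-member's one-step law; joint `Lc`-covariance of the comb unit tower (generic `d`) -/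

section Inputs

variable {d : ℕ} {Lc : ℕ} [NeZero Lc]

/-- [folklore] **THE `ε`-MEMBER's ONE-STEP LAW FOR THE COMB-CHART TOWER**: `y_{j+1} = 𝒜^{G′}_j y_j + ½ • (b̃′_j + ε • P b̃′_j)` with `y_j = ½ • (T̃′_j + ε • P T̃′_j)`,
`𝒜^{G′}_j = lin4 c₄ (unitK_j (GcombSh Lc j)) Lc`, `b̃′_j` the comb-chart dressed source — leaf-01 g72's `halfMember_succ_eq` at the comb data: road-P2's slot-generic (F1) step
`unitS₂_T2RecOf_succ_eq_lin4_add` with `step_data_of_letters` ∕ `bdd₄_unitS₂_T2RecOf_of_letters` (the record's letters, an2's `decays_GcombSh` ∕ `locStencil_SpureCombOf`), the parity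
through the dressed comb step by `CombAffineUnrollProjected.sgnK_trK_lin4_unitK_GcombSh`. -/
theorem halfMember_comb_succ_eq (tabs : SymTables d Lc) (cE cVH cΛ cE₂ cB : ℝ) (Tc : Fin 4 → Fin 4 → Fin 4 → Fin 4 → ℝ)
    (hBff : ∀ κ u κ' u' x z (α β : Fin (d + 1)), tabs.vh₂S κ u κ' u' x z (Sum.inl α) (Sum.inl β) = 0)
    (hBmm : ∀ κ u κ' u' x z (μ ν : Fin (d + 1)), tabs.vh₂S κ u κ' u' x z (Sum.inr μ) (Sum.inr ν) = 0) (ε : ℝ) (j : ℕ) :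
    ((1 / 2 : ℝ) • (unitS₂ (sfStep Lc (j + 1)) (smStep d Lc (j + 1)) (T2RecOf d Lc (GcombSh Lc) (SpureCombOf tabs cE cVH cΛ) tabs.M cE₂ cB Tc tabs.vh₂S tabs.mixFF (j + 1))
          + ε • fun κ u κ' u' => sgnK (trK (unitS₂ (sfStep Lc (j + 1)) (smStep d Lc (j + 1))
            (T2RecOf d Lc (GcombSh Lc) (SpureCombOf tabs cE cVH cΛ) tabs.M cE₂ cB Tc tabs.vh₂S tabs.mixFF (j + 1)) κ u κ' u'))))
      = lin4 (cE₂ * (Lc : ℝ) ^ (2 * (d + 1))) (unitK (sfStep Lc j) (smStep d Lc j) (GcombSh (d := d) Lc j)) Lc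
          ((1 / 2 : ℝ) • (unitS₂ (sfStep Lc j) (smStep d Lc j) (T2RecOf d Lc (GcombSh Lc) (SpureCombOf tabs cE cVH cΛ) tabs.M cE₂ cB Tc tabs.vh₂S tabs.mixFF j)
          + ε • fun κ u κ' u' => sgnK (trK (unitS₂ (sfStep Lc j) (smStep d Lc j)
            (T2RecOf d Lc (GcombSh Lc) (SpureCombOf tabs cE cVH cΛ) tabs.M cE₂ cB Tc tabs.vh₂S tabs.mixFF j) κ u κ' u'))))
        + ((1 / 2 : ℝ) • ((fun κ u κ' u' => (cE₂ * (Lc : ℝ) ^ (2 * (d + 1))) • mmRead Lc (K3OfK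
            (unitK (sfStep Lc j) (smStep d Lc j) (GcombSh (d := d) Lc j)) Lc
            (unitS (sfStep Lc j) (smStep d Lc j) (SpureCombOf tabs cE cVH cΛ j)) (unitM (sfStep Lc j) (smStep d Lc j) (tabs.M j))
            (W2SymOfK (unitK (sfStep Lc j) (smStep d Lc j) (GcombSh (d := d) Lc j)) Lc
              (unitS (sfStep Lc j) (smStep d Lc j) (SpureCombOf tabs cE cVH cΛ j)) (unitM (sfStep Lc j) (smStep d Lc j) (tabs.M j)) 0
              (unitM₂ (sfStep Lc j) (smStep d Lc j) (M2Of d Lc tabs.mixFF j))) κ u κ' u') + cB • tabs.vh₂S κ u κ' u')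
          + ε • fun κ u κ' u' => sgnK (trK ((fun κ u κ' u' => (cE₂ * (Lc : ℝ) ^ (2 * (d + 1))) • mmRead Lc (K3OfK
            (unitK (sfStep Lc j) (smStep d Lc j) (GcombSh (d := d) Lc j)) Lc
            (unitS (sfStep Lc j) (smStep d Lc j) (SpureCombOf tabs cE cVH cΛ j)) (unitM (sfStep Lc j) (smStep d Lc j) (tabs.M j))
            (W2SymOfK (unitK (sfStep Lc j) (smStep d Lc j) (GcombSh (d := d) Lc j)) Lc
              (unitS (sfStep Lc j) (smStep d Lc j) (SpureCombOf tabs cE cVH cΛ j)) (unitM (sfStep Lc j) (smStep d Lc j) (tabs.M j)) 0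
              (unitM₂ (sfStep Lc j) (smStep d Lc j) (M2Of d Lc tabs.mixFF j))) κ u κ' u') + cB • tabs.vh₂S κ u κ' u') κ u κ' u')))) := by
  have hLc : 1 ≤ Lc := NeZero.one_le
  -- road-P2's (F1) step at the comb letters: `T̃′_{j+1} = 𝒜^{G′}_j T̃′_j + b̃′_j`
  obtain ⟨C, δ, C₀, C₁, hδ, hK, h₀, hW⟩ := step_data_of_letters (GcombSh Lc) (SpureCombOf tabs cE cVH cΛ) tabs.M cE₂ cB Tc hLc
      (decays_GcombSh (d := d) Lc) (locStencil_SpureCombOf tabs cE cVH cΛ) tabs.hM tabs.hB tabs.hmix j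
  have hstep := unitS₂_T2RecOf_succ_eq_lin4_add (GcombSh Lc) (SpureCombOf tabs cE cVH cΛ) tabs.M cE₂ cB Tc tabs.vh₂S tabs.mixFF hBff hBmm j hδ hK h₀ hW
  -- the member is bounded, and so is its parity image
  have hbU := bdd₄_unitS₂_T2RecOf_of_letters (GcombSh Lc) (SpureCombOf tabs cE cVH cΛ) tabs.M cE₂ cB Tc hLc
      (decays_GcombSh (d := d) Lc) (locStencil_SpureCombOf tabs cE cVH cΛ) tabs.hM tabs.hB tabs.hmix j
  have hbP := bdd₄_smul ε (bdd₄_parity hbU)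
  obtain ⟨δK, CK, hδK, -, hG⟩ := decays_GcombSh (d := d) Lc j
  rw [hstep, parity_add, sgnK_trK_lin4_unitK_GcombSh j _ _ _ _ hbU, lin4_smul,
    lin4_add_of_bdd₄ (decays_unitK (sf := sfStep Lc j) (sm := smStep d Lc j) hG) hδK _ _ hbU hbP, lin4_smul]
  simp only [smul_add]
  abel

/-- [folklore] **THE COMB-CHART UNIT `T₂` TOWER IS JOINTLY `Lc`-COVARIANT**: every member `unitS₂_j (T2RecOf d Lc (GcombSh Lc) (SpureCombOf tabs …) tabs.M … j)` commutes with
block translations (an2's `RecursiveWSlot.T2RecOf_translate` with `shiftK_GcombSh`, `SpureCombOf_translate`, the record's (TM)(TB)(Tmix); leaf-01's `unitS₂_translate`). -/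
theorem unitS₂_T2RecOf_comb_translate (tabs : SymTables d Lc) (cE cVH cΛ cE₂ cB : ℝ) (Tc : Fin 4 → Fin 4 → Fin 4 → Fin 4 → ℝ)
    (j : ℕ) (κ : Fin (d + 1)) (u : Fin (d + 1) → ℤ) (κ' : Fin (d + 1)) (u' t : Fin (d + 1) → ℤ) :
    (unitS₂ (sfStep Lc j) (smStep d Lc j) (T2RecOf d Lc (GcombSh Lc) (SpureCombOf tabs cE cVH cΛ) tabs.M cE₂ cB Tc tabs.vh₂S tabs.mixFF j)) κ (u + (Lc : ℤ) • t) κ'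
        (u' + (Lc : ℤ) • t)
      = shiftK (-((Lc : ℤ) • t)) ((unitS₂ (sfStep Lc j) (smStep d Lc j)
          (T2RecOf d Lc (GcombSh Lc) (SpureCombOf tabs cE cVH cΛ) tabs.M cE₂ cB Tc tabs.vh₂S tabs.mixFF j)) κ u κ' u') :=
  unitS₂_translate (w := (Lc : ℤ) • t) (v := -((Lc : ℤ) • t)) (sfStep Lc j) (smStep d Lc j)
    (fun κ u κ' u' => T2RecOf_translate (G := GcombSh Lc) (S := SpureCombOf tabs cE cVH cΛ) (M := tabs.M) (cE₂ := cE₂) (cB := cB) (T := Tc)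
      (vh₂S := tabs.vh₂S) (mixFF := tabs.mixFF) (shiftK_GcombSh (d := d) Lc) (SpureCombOf_translate tabs cE cVH cΛ) tabs.hMt tabs.hBt tabs.hmixt j κ u κ' u' t)
    κ u κ' u'

end Inputs

/-! ## §2 `d = 3`: the DRIFT socket at the comb-chart slot data, relative-source rows displayed -/

section Three

variable {Lc : ℕ} [NeZero Lc]

/-- **LINK L8c′ AT (III′): THE «T2Drift^ε» SOCKET FOR THE COMB-CHART `T₂` TOWER** [our bookkeeping; folklore composition] (`d = 3`, `2 ≤ Lc`, the EXACT pin `cE₂ = +Lc⁸`,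
every `ε`, every `cE cVH cΛ cB Tc`, any `tabs : SymTables 3 Lc` whose border `tabs.vh₂S` is off-diagonal (`hBff hBmm`; its `LocStencil₂` class is the record's `tabs.hB`, so the (E) binders `hB hδB` are GONE)): under «T2Shape^ε»
(`hy`), the two rows of the RELATIVE source `b′^{rel,ε}_l = ½ • (b̃′_l + ε • P b̃′_l) + (𝒜^{G′}_l y_l − 𝒜^K_l y_l)` (`hb`, `hZ`) and its one-step DRIFT row (`hbd`), the `ε`-member
has road W3's «T2Drift»: ONE-STEP geometric rate and CAUCHY form at one rate.  Proof = MY (E) socket's TOKEN FOR TOKEN with §1's two comb inputs; every engine chart-free. -/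
theorem rate_halfMember_comb_three_of_relSource_rows (hLc : 2 ≤ Lc) (tabs : SymTables 3 Lc) (cE cVH cΛ cE₂ cB : ℝ)
    (hpinEq : cE₂ = (Lc : ℝ) ^ (2 * (3 + 1))) (Tc : Fin 4 → Fin 4 → Fin 4 → Fin 4 → ℝ)
    (hBff : ∀ κ u κ' u' x z (α β : Fin (3 + 1)), tabs.vh₂S κ u κ' u' x z (Sum.inl α) (Sum.inl β) = 0)
    (hBmm : ∀ κ u κ' u' x z (μ ν : Fin (3 + 1)), tabs.vh₂S κ u κ' u' x z (Sum.inr μ) (Sum.inr ν) = 0)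
    (ε : ℝ) {Cy δy Cb δb Cbd θb δbd : ℝ}
    (hy : ∀ n, LocStencil₂ (((1 : ℝ) / 2) • (unitS₂ (sfStep Lc n) (smStep 3 Lc n) (T2RecOf 3 Lc (GcombSh Lc) (SpureCombOf tabs cE cVH cΛ) tabs.M cE₂ cB Tc tabs.vh₂S tabs.mixFF n) + ε • fun κ u κ' u' => sgnK (trK ((unitS₂ (sfStep Lc n)
      (smStep 3 Lc n) (T2RecOf 3 Lc (GcombSh Lc) (SpureCombOf tabs cE cVH cΛ) tabs.M cE₂ cB Tc tabs.vh₂S tabs.mixFF n)) κ u κ' u')))) Cy δy) (hδy : 0 < δy)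
    (hb : ∀ l, LocStencil₂
      (((1 : ℝ) / 2) • ((fun κ u κ' u' => (cE₂ * (Lc : ℝ) ^ (2 * (3 + 1))) • mmRead Lc (K3OfK (unitK (sfStep Lc l) (smStep 3 Lc l) (GcombSh (d := 3) Lc l)) Lc (unitS
        (sfStep Lc l) (smStep 3 Lc l) (SpureCombOf tabs cE cVH cΛ l)) (unitM (sfStep Lc l) (smStep 3 Lc l) (tabs.M l)) (W2SymOfK (unitK (sfStep Lc l) (smStep 3 Lc l)
        (GcombSh (d := 3) Lc l)) Lc (unitS (sfStep Lc l) (smStep 3 Lc l) (SpureCombOf tabs cE cVH cΛ l)) (unitM (sfStep Lc l) (smStep 3 Lc l) (tabs.M l)) 0 (unitM₂ (sfStep Lc l) (smStep 3 Lc l) (M2Of 3 Lc tabs.mixFF l))) κ u κ' u') + cB • tabs.vh₂S κ u κ' u') + ε • fun κ u κ' u' => sgnK (trK ((cE₂ * (Lc : ℝ) ^ (2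
        * (3 + 1))) • mmRead Lc (K3OfK (unitK (sfStep Lc l) (smStep 3 Lc l) (GcombSh (d := 3) Lc l)) Lc (unitS (sfStep Lc l) (smStep 3 Lc l) (SpureCombOf tabs cE cVH cΛ l)) (unitM (sfStep Lc l) (smStep 3 Lc l) (tabs.M l)) (W2SymOfK (unitK (sfStep Lc l) (smStep 3 Lc l) (GcombSh (d := 3) Lc l)) Lc (unitS (sfStep Lc l) (smStep 3 Lc l) (SpureCombOf tabs cE cVH cΛ l)) (unitM (sfStep Lc l) (smStep 3 Lc l) (tabs.M l)) 0 (unitM₂ (sfStep Lc l)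
        (smStep 3 Lc l) (M2Of 3 Lc tabs.mixFF l))) κ u κ' u') + cB • tabs.vh₂S κ u κ' u'))) + (lin4 (cE₂ * (Lc : ℝ) ^ (2 * (3 + 1))) (unitK (sfStep Lc l) (smStep 3 Lc l) (GcombSh (d := 3) Lc l)) Lc (((1 : ℝ) / 2) • (unitS₂ (sfStep Lc l) (smStep 3 Lc l) (T2RecOf 3 Lc (GcombSh Lc) (SpureCombOf tabs cE cVH cΛ) tabs.M cE₂ cB Tc tabs.vh₂S tabs.mixFF l) + ε • fun
        κ u κ' u' => sgnK (trK ((unitS₂ (sfStep Lc l) (smStep 3 Lc l) (T2RecOf 3 Lc (GcombSh Lc) (SpureCombOf tabs cE cVH cΛ) tabs.M cE₂ cB Tc tabs.vh₂S tabs.mixFF l)) κ u κ' u')))) - lin4 (cE₂ * (Lc : ℝ) ^ (2 * (3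
        + 1))) (unitK (sfStep Lc l) (smStep 3 Lc l) (KInvStep (d := 3) Lc l)) Lc (((1 : ℝ) / 2) • (unitS₂ (sfStep Lc l) (smStep 3 Lc l) (T2RecOf 3 Lc (GcombSh Lc) (SpureCombOf tabs cE cVH cΛ) tabs.M cE₂ cB Tc tabs.vh₂S tabs.mixFF l) + ε • fun κ u κ' u' => sgnK (trK ((unitS₂ (sfStep Lc l) (smStep 3 Lc l) (T2RecOf 3 Lc (GcombSh Lc) (SpureCombOf tabs cE cVH cΛ) tabs.M cE₂ cB Tc tabs.vh₂S tabs.mixFF l)) κ u κ' u')))))) Cb δb)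
    (hδb : 0 < δb)
    (hZ : ∀ l,
      (∀ (κ : Fin (3 + 1)) (u : Fin (3 + 1) → ℤ) (κ' : Fin (3 + 1)) (u' t : Fin (3 + 1) → ℤ), (((1 : ℝ) / 2) • ((fun κ u κ' u' => (cE₂ * (Lc : ℝ) ^ (2 * (3 + 1))) • mmRead Lc (K3OfK (unitK (sfStep Lc
        l) (smStep 3 Lc l) (GcombSh (d := 3) Lc l)) Lc (unitS (sfStep Lc l) (smStep 3 Lc l) (SpureCombOf tabs cE cVH cΛ l)) (unitM (sfStep Lc l) (smStep 3
        Lc l) (tabs.M l)) (W2SymOfK (unitK (sfStep Lc l) (smStep 3 Lc l) (GcombSh (d := 3) Lc l)) Lc (unitS (sfStep Lc l) (smStep 3 Lc l)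
        (SpureCombOf tabs cE cVH cΛ l)) (unitM (sfStep Lc l) (smStep 3 Lc l) (tabs.M l)) 0 (unitM₂ (sfStep Lc l) (smStep 3 Lc l) (M2Of 3 Lc tabs.mixFF l))) κ u κ' u') + cB • tabs.vh₂S κ u κ' u') + ε • fun κ u κ' u' => sgnK (trK ((cE₂ * (Lc : ℝ) ^ (2 * (3 + 1))) • mmRead Lc (K3OfK (unitK (sfStep Lc l) (smStep 3 Lc l) (GcombSh (d := 3) Lc l)) Lc (unitS (sfStep Lc l) (smStep 3 Lc l) (SpureCombOf tabs cE cVH cΛ l)) (unitM (sfStep Lc l) (smStep 3 Lc l) (tabs.M l))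
        (W2SymOfK (unitK (sfStep Lc l) (smStep 3 Lc l) (GcombSh (d := 3) Lc l)) Lc (unitS (sfStep Lc l) (smStep 3 Lc l) (SpureCombOf tabs cE cVH cΛ l))
        (unitM (sfStep Lc l) (smStep 3 Lc l) (tabs.M l)) 0 (unitM₂ (sfStep Lc l) (smStep 3 Lc l) (M2Of 3 Lc tabs.mixFF l))) κ u κ' u') + cB • tabs.vh₂S κ u κ' u'))) +
        (lin4 (cE₂ * (Lc : ℝ) ^ (2 * (3 + 1))) (unitK (sfStep Lc l) (smStep 3 Lc l) (GcombSh (d := 3) Lc l)) Lc (((1 : ℝ) / 2) • (unitS₂ (sfStep Lc l) (smStep 3 Lc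
        l) (T2RecOf 3 Lc (GcombSh Lc) (SpureCombOf tabs cE cVH cΛ) tabs.M cE₂ cB Tc tabs.vh₂S tabs.mixFF l) + ε • fun κ u κ' u' => sgnK (trK ((unitS₂ (sfStep Lc l) (smStep 3 Lc l) (T2RecOf 3 Lc (GcombSh Lc) (SpureCombOf tabs cE cVH cΛ) tabs.M cE₂ cB Tc tabs.vh₂S tabs.mixFF l)) κ u κ' u')))) - lin4 (cE₂ * (Lc : ℝ) ^ (2 * (3 + 1))) (unitK (sfStep Lc l) (smStep 3 Lc l) (KInvStep (d := 3) Lc l)) Lc (((1 : ℝ) / 2) •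
        (unitS₂ (sfStep Lc l) (smStep 3 Lc l) (T2RecOf 3 Lc (GcombSh Lc) (SpureCombOf tabs cE cVH cΛ) tabs.M cE₂ cB Tc tabs.vh₂S tabs.mixFF l) + ε • fun κ u κ' u' => sgnK (trK ((unitS₂ (sfStep Lc l) (smStep 3 Lc l)
        (T2RecOf 3 Lc (GcombSh Lc) (SpureCombOf tabs cE cVH cΛ) tabs.M cE₂ cB Tc tabs.vh₂S tabs.mixFF l)) κ u κ' u')))))) κ (u + (Lc : ℤ) • t) κ' (u' + (Lc : ℤ) • t) = shiftK (-((Lc : ℤ) • t)) ((((1 : ℝ) / 2) •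
        ((fun κ u κ' u' => (cE₂ * (Lc : ℝ) ^ (2 * (3 + 1))) • mmRead Lc (K3OfK (unitK (sfStep Lc l) (smStep 3 Lc l) (GcombSh (d := 3) Lc l)) Lc (unitS (sfStep Lc l)
        (smStep 3 Lc l) (SpureCombOf tabs cE cVH cΛ l)) (unitM (sfStep Lc l) (smStep 3 Lc l) (tabs.M l)) (W2SymOfK (unitK (sfStep Lc l) (smStep 3 Lc l) (GcombSh (d := 3) Lc l)) Lc (unitS (sfStep Lc l) (smStep 3 Lc l) (SpureCombOf tabs cE cVH cΛ l)) (unitM (sfStep Lc l) (smStep 3 Lc l) (tabs.M l)) 0 (unitM₂ (sfStep Lc l) (smStep 3 Lc l) (M2Of 3 Lc tabs.mixFF l))) κ u κ' u') + cB • tabs.vh₂S κ u κ' u') + ε • fun κ u κ' u' => sgnK (trK ((cE₂ * (Lc : ℝ) ^ (2 * (3 + 1))) •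
        mmRead Lc (K3OfK (unitK (sfStep Lc l) (smStep 3 Lc l) (GcombSh (d := 3) Lc l)) Lc (unitS (sfStep Lc l) (smStep 3 Lc l) (SpureCombOf tabs cE cVH cΛ l)) (unitM (sfStep Lc l) (smStep 3 Lc l) (tabs.M l)) (W2SymOfK (unitK (sfStep Lc l) (smStep 3 Lc l) (GcombSh (d := 3) Lc l)) Lc (unitS
        (sfStep Lc l) (smStep 3 Lc l) (SpureCombOf tabs cE cVH cΛ l)) (unitM (sfStep Lc l) (smStep 3 Lc l) (tabs.M l)) 0 (unitM₂ (sfStep Lc l) (smStep 3 Lc l) (M2Of 3 Lc tabs.mixFF l))) κ u κ' u') + cB • tabs.vh₂S κ u κ' u'))) + (lin4 (cE₂ * (Lc : ℝ) ^ (2 * (3 + 1))) (unitK (sfStep Lc l) (smStep 3 Lc l) (GcombSh (d := 3) Lc l)) Lc (((1 : ℝ) / 2) • (unitS₂ (sfStep Lc l) (smStep 3 Lc l) (T2RecOf 3 Lc (GcombSh Lc) (SpureCombOf tabs cE cVH cΛ) tabs.M cE₂ cB Tc tabs.vh₂S tabs.mixFF l) + ε • fun κ u κ' u' => sgnK (t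rK
        ((unitS₂ (sfStep Lc l) (smStep 3 Lc l) (T2RecOf 3 Lc (GcombSh Lc) (SpureCombOf tabs cE cVH cΛ) tabs.M cE₂ cB Tc tabs.vh₂S tabs.mixFF l)) κ u κ' u')))) - lin4 (cE₂ * (Lc : ℝ) ^ (2 * (3 + 1))) (unitK (sfStep
        Lc l) (smStep 3 Lc l) (KInvStep (d := 3) Lc l)) Lc (((1 : ℝ) / 2) • (unitS₂ (sfStep Lc l) (smStep 3 Lc l) (T2RecOf 3 Lc (GcombSh Lc) (SpureCombOf tabs cE cVH cΛ) tabs.M cE₂ cB Tc tabs.vh₂S tabs.mixFF l) + ε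
        • fun κ u κ' u' => sgnK (trK ((unitS₂ (sfStep Lc l) (smStep 3 Lc l) (T2RecOf 3 Lc (GcombSh Lc) (SpureCombOf tabs cE cVH cΛ) tabs.M cE₂ cB Tc tabs.vh₂S tabs.mixFF l)) κ u κ' u')))))) κ u κ' u')) ∧
      (∀ κ κ' κ₁ κ₂, zmode Lc (((1 : ℝ) / 2) • ((fun κ u κ' u' => (cE₂ * (Lc : ℝ) ^ (2 * (3 + 1))) • mmRead Lc (K3OfK (unitK (sfStep Lc l) (smStep 3 Lc l) (GcombSh (d := 3) Lc l)) Lc (unitS (sfStep Lc l) (smStep 3 Lc l) (SpureCombOf tabs cE cVH cΛ l)) (unitM (sfStep Lc l) (smStep 3 Lc l) (tabs.M l)) (W2SymOfK (unitK (sfStep Lc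
        l) (smStep 3 Lc l) (GcombSh (d := 3) Lc l)) Lc (unitS (sfStep Lc l) (smStep 3 Lc l) (SpureCombOf tabs cE cVH cΛ l)) (unitM (sfStep Lc l) (smStep 3
        Lc l) (tabs.M l)) 0 (unitM₂ (sfStep Lc l) (smStep 3 Lc l) (M2Of 3 Lc tabs.mixFF l))) κ u κ' u') + cB • tabs.vh₂S κ u κ' u') + ε • fun κ u κ' u' => sgnK (trK
        ((cE₂ * (Lc : ℝ) ^ (2 * (3 + 1))) • mmRead Lc (K3OfK (unitK (sfStep Lc l) (smStep 3 Lc l) (GcombSh (d := 3) Lc l)) Lc (unitS (sfStep Lc l) (smStep 3 Lc l)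
        (SpureCombOf tabs cE cVH cΛ l)) (unitM (sfStep Lc l) (smStep 3 Lc l) (tabs.M l)) (W2SymOfK (unitK (sfStep Lc l) (smStep 3 Lc l) (GcombSh (d := 3) Lc l)) Lc (unitS (sfStep Lc l) (smStep 3 Lc l) (SpureCombOf tabs cE cVH cΛ l)) (unitM (sfStep Lc l) (smStep 3 Lc l) (tabs.M l)) 0 (unitM₂
        (sfStep Lc l) (smStep 3 Lc l) (M2Of 3 Lc tabs.mixFF l))) κ u κ' u') + cB • tabs.vh₂S κ u κ' u'))) + (lin4 (cE₂ * (Lc : ℝ) ^ (2 * (3 + 1))) (unitK (sfStep Lc l) (smStep 3 Lc l)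
        (GcombSh (d := 3) Lc l)) Lc (((1 : ℝ) / 2) • (unitS₂ (sfStep Lc l) (smStep 3 Lc l) (T2RecOf 3 Lc (GcombSh Lc) (SpureCombOf tabs cE cVH cΛ) tabs.M cE₂ cB Tc tabs.vh₂S tabs.mixFF l) + ε • fun κ u κ' u' => sgnK (trK ((unitS₂ (sfStep Lc l) (smStep 3 Lc l) (T2RecOf 3 Lc (GcombSh Lc) (SpureCombOf tabs cE cVH cΛ) tabs.M cE₂ cB Tc tabs.vh₂S tabs.mixFF l)) κ u κ' u')))) - lin4 (cE₂ * (Lc :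
        ℝ) ^ (2 * (3 + 1))) (unitK (sfStep Lc l) (smStep 3 Lc l) (KInvStep (d := 3) Lc l)) Lc (((1 : ℝ) / 2) • (unitS₂ (sfStep Lc l) (smStep 3 Lc l) (T2RecOf 3 Lc (GcombSh Lc) (SpureCombOf tabs cE cVH cΛ) tabs.M cE₂ cB Tc tabs.vh₂S tabs.mixFF l) + ε • fun κ u κ' u' => sgnK (trK ((unitS₂ (sfStep Lc l) (smStep 3 Lc l) (T2RecOf 3 Lc (GcombSh Lc) (SpureCombOf tabs cE cVH cΛ) tabs.M cE₂ cB Tc tabs.vh₂S tabs.mixFF l)) κ u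
        κ' u')))))) κ κ' (Sum.inl κ₁) (Sum.inl κ₂) + zmode Lc (((1 : ℝ) / 2) • ((fun κ u κ' u' => (cE₂ * (Lc : ℝ) ^ (2 * (3 + 1))) • mmRead Lc (K3OfK (unitK (sfStep Lc l) (smStep 3 Lc l)
        (GcombSh (d := 3) Lc l)) Lc (unitS (sfStep Lc l) (smStep 3 Lc l) (SpureCombOf tabs cE cVH cΛ l)) (unitM (sfStep Lc l) (smStep 3 Lc l) (tabs.M l)) (W2SymOfK (unitK (sfStep Lc l) (smStep 3 Lc l) (GcombSh (d := 3) Lc l)) Lc (unitS (sfStep Lc l) (smStep 3 Lc l) (SpureCombOf tabs cE cVH cΛ l)) (unitM (sfStep Lc l) (smStep 3 Lc l) (tabs.M l)) 0 (unitM₂ (sfStep Lc l) (smStep 3 Lc l) (M2Of 3 Lc tabs.mixFF l))) κ u κ' u') + cB • tabs.vh₂S κ u κ' u') + ε • fun κ u κ' u' => sgnK (trK ((cE₂ * (Lc : ℝ) ^ (2 * (3 + 1))) • mmRead Lc (K3OfK (unitK (sfStep Lc l) (smStep 3 Lc l) (GcombSh (d := 3) Lc l)) Lc (unitS (sfStep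 Lc l) (smStep 3 Lc l) (SpureCombOf tabs cE cVH cΛ l)) (unitM (sfStep Lc l) (smStep 3 Lc l) (tabs.M l)) (W2SymOfK (unitK (sfStep Lc l)
        (smStep 3 Lc l) (GcombSh (d := 3) Lc l)) Lc (unitS (sfStep Lc l) (smStep 3 Lc l) (SpureCombOf tabs cE cVH cΛ l)) (unitM (sfStep Lc l) (smStep 3 Lc
        l) (tabs.M l)) 0 (unitM₂ (sfStep Lc l) (smStep 3 Lc l) (M2Of 3 Lc tabs.mixFF l))) κ u κ' u') + cB • tabs.vh₂S κ u κ' u'))) + (lin4 (cE₂ * (Lc : ℝ) ^ (2 * (3 +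
        1))) (unitK (sfStep Lc l) (smStep 3 Lc l) (GcombSh (d := 3) Lc l)) Lc (((1 : ℝ) / 2) • (unitS₂ (sfStep Lc l) (smStep 3 Lc l) (T2RecOf 3 Lc (GcombSh Lc) (SpureCombOf tabs cE cVH cΛ) tabs.M cE₂ cB Tc tabs.vh₂S tabs.mixFF l) + ε • fun κ u κ' u' => sgnK (trK ((unitS₂ (sfStep Lc l) (smStep 3 Lc l) (T2RecOf 3 Lc (GcombSh Lc) (SpureCombOf tabs cE cVH cΛ) tabs.M cE₂ cB Tc tabs.vh₂S tabs.mixFF l)) κ u κ' u')))) - lin4 (cE₂ * (Lc : ℝ) ^ (2 * (3 + 1))) (unitK (sfStep Lc l) (smStep 3 Lc l) (KInvStep (d := 3) Lc l)) Lc (((1 : ℝ) / 2) • (unitS₂ (sfStep Lc l) (smStep 3 Lc l)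
        (T2RecOf 3 Lc (GcombSh Lc) (SpureCombOf tabs cE cVH cΛ) tabs.M cE₂ cB Tc tabs.vh₂S tabs.mixFF l) + ε • fun κ u κ' u' => sgnK (trK ((unitS₂ (sfStep Lc l) (smStep 3 Lc l) (T2RecOf 3 Lc (GcombSh Lc) (SpureCombOf tabs cE cVH cΛ) tabs.M cE₂ cB Tc tabs.vh₂S tabs.mixFF l)) κ u κ' u')))))) κ' κ (Sum.inl κ₁) (Sum.inl κ₂) = 0))
    (hbd : ∀ l, LocStencil₂
      ((((1 : ℝ) / 2) • ((fun κ u κ' u' => (cE₂ * (Lc : ℝ) ^ (2 * (3 + 1))) • mmRead Lc (K3OfK (unitK (sfStep Lc (l + 1)) (smStep 3 Lc (l + 1)) (GcombSh (d := 3) Lc (l + 1))) Lc (unitS (sfStep Lc (l + 1)) (smStep 3 Lc (l + 1)) (SpureCombOf tabs cE cVH cΛ (l + 1))) (unitM (sfStep Lc (l + 1)) (smStep 3 Lc (l + 1)) (tabs.M (l + 1))) (W2SymOfK (unitK (sfStep Lc (l + 1)) (smStep 3 Lc (l + 1)) (GcombSh (d := 3) Lc (l + 1))) Lc (unitS (sfStep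 Lc (l + 1)) (smStep 3 Lc (l + 1))
        (SpureCombOf tabs cE cVH cΛ (l + 1))) (unitM (sfStep Lc (l + 1)) (smStep 3 Lc (l + 1)) (tabs.M (l + 1))) 0 (unitM₂ (sfStep Lc (l + 1)) (smStep 3 Lc (l + 1))
        (M2Of 3 Lc tabs.mixFF (l + 1)))) κ u κ' u') + cB • tabs.vh₂S κ u κ' u') + ε • fun κ u κ' u' => sgnK (trK ((cE₂ * (Lc : ℝ) ^ (2 * (3 + 1))) • mmRead Lc (K3OfK (unitK (sfStep Lc (l
        + 1)) (smStep 3 Lc (l + 1)) (GcombSh (d := 3) Lc (l + 1))) Lc (unitS (sfStep Lc (l + 1)) (smStep 3 Lc (l + 1)) (SpureCombOf tabs cE cVH cΛ (l + 1))) (unitM (sfStep Lc (l + 1)) (smStep 3 Lc (l + 1)) (tabs.M (l + 1))) (W2SymOfK (unitK (sfStep Lc (l + 1)) (smStep 3 Lc (l + 1)) (GcombSh (d := 3) Lc (l + 1))) Lc (unitS (sfStep Lc (l + 1)) (smStep 3 Lc (l + 1)) (SpureCombOf tabs cE cVH cΛ (l + 1))) (unitM (sfStep Lc (l + 1)) (smStep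 3 Lc (l + 1)) (tabs.M (l + 1))) 0 (unitM₂ (sfStep Lc (l + 1)) (smStep 3 Lc (l + 1)) (M2Of 3 Lc tabs.mixFF (l + 1)))) κ u κ' u') + cB • tabs.vh₂S κ u κ' u'))) + (lin4 (cE₂ * (Lc : ℝ) ^ (2
        * (3 + 1))) (unitK (sfStep Lc (l + 1)) (smStep 3 Lc (l + 1)) (GcombSh (d := 3) Lc (l + 1))) Lc (((1 : ℝ) / 2) • (unitS₂ (sfStep Lc (l + 1)) (smStep 3 Lc (l
        + 1)) (T2RecOf 3 Lc (GcombSh Lc) (SpureCombOf tabs cE cVH cΛ) tabs.M cE₂ cB Tc tabs.vh₂S tabs.mixFF (l + 1)) + ε • fun κ u κ' u' => sgnK (trK ((unitS₂ (sfStep Lc (l + 1)) (smStep 3 Lc (l + 1)) (T2RecOf 3 Lc (GcombSh Lc) (SpureCombOf tabs cE cVH cΛ) tabs.M cE₂ cB Tc tabs.vh₂S tabs.mixFF (l + 1))) κ u κ' u')))) - lin4 (cE₂ * (Lc : ℝ) ^ (2 * (3 + 1))) (unitK (sfStep Lc (l + 1)) (smStep 3 Lc (l + 1)) (KInvStep 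(d
        := 3) Lc (l + 1))) Lc (((1 : ℝ) / 2) • (unitS₂ (sfStep Lc (l + 1)) (smStep 3 Lc (l + 1)) (T2RecOf 3 Lc (GcombSh Lc) (SpureCombOf tabs cE cVH cΛ) tabs.M cE₂ cB Tc tabs.vh₂S tabs.mixFF (l + 1)) + ε • fun κ u
        κ' u' => sgnK (trK ((unitS₂ (sfStep Lc (l + 1)) (smStep 3 Lc (l + 1)) (T2RecOf 3 Lc (GcombSh Lc) (SpureCombOf tabs cE cVH cΛ) tabs.M cE₂ cB Tc tabs.vh₂S tabs.mixFF (l + 1))) κ u κ' u')))))) -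
       (((1 : ℝ) / 2) • ((fun κ u κ' u' => (cE₂ * (Lc : ℝ) ^ (2 * (3 + 1))) • mmRead Lc (K3OfK (unitK (sfStep Lc l) (smStep 3 Lc l) (GcombSh (d := 3) Lc l)) Lc (unitS
        (sfStep Lc l) (smStep 3 Lc l) (SpureCombOf tabs cE cVH cΛ l)) (unitM (sfStep Lc l) (smStep 3 Lc l) (tabs.M l)) (W2SymOfK (unitK (sfStep Lc l) (smStep 3 Lc l)
        (GcombSh (d := 3) Lc l)) Lc (unitS (sfStep Lc l) (smStep 3 Lc l) (SpureCombOf tabs cE cVH cΛ l)) (unitM (sfStep Lc l) (smStep 3 Lc l) (tabs.M l)) 0 (unitM₂ (sfStep Lc l) (smStep 3 Lc l) (M2Of 3 Lc tabs.mixFF l))) κ u κ' u') + cB • tabs.vh₂S κ u κ' u') + ε • fun κ u κ' u' => sgnK (trK ((cE₂ * (Lc : ℝ) ^ (2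
        * (3 + 1))) • mmRead Lc (K3OfK (unitK (sfStep Lc l) (smStep 3 Lc l) (GcombSh (d := 3) Lc l)) Lc (unitS (sfStep Lc l) (smStep 3 Lc l) (SpureCombOf tabs cE cVH cΛ l)) (unitM (sfStep Lc l) (smStep 3 Lc l) (tabs.M l)) (W2SymOfK (unitK (sfStep Lc l) (smStep 3 Lc l) (GcombSh (d := 3) Lc l)) Lc (unitS (sfStep Lc l) (smStep 3 Lc l) (SpureCombOf tabs cE cVH cΛ l)) (unitM (sfStep Lc l) (smStep 3 Lc l) (tabs.M l)) 0 (unitM₂ (sfStep Lc l)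
        (smStep 3 Lc l) (M2Of 3 Lc tabs.mixFF l))) κ u κ' u') + cB • tabs.vh₂S κ u κ' u'))) + (lin4 (cE₂ * (Lc : ℝ) ^ (2 * (3 + 1))) (unitK (sfStep Lc l) (smStep 3 Lc l) (GcombSh (d := 3) Lc l)) Lc (((1 : ℝ) / 2) • (unitS₂ (sfStep Lc l) (smStep 3 Lc l) (T2RecOf 3 Lc (GcombSh Lc) (SpureCombOf tabs cE cVH cΛ) tabs.M cE₂ cB Tc tabs.vh₂S tabs.mixFF l) + ε • fun
        κ u κ' u' => sgnK (trK ((unitS₂ (sfStep Lc l) (smStep 3 Lc l) (T2RecOf 3 Lc (GcombSh Lc) (SpureCombOf tabs cE cVH cΛ) tabs.M cE₂ cB Tc tabs.vh₂S tabs.mixFF l)) κ u κ' u')))) - lin4 (cE₂ * (Lc : ℝ) ^ (2 * (3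
        + 1))) (unitK (sfStep Lc l) (smStep 3 Lc l) (KInvStep (d := 3) Lc l)) Lc (((1 : ℝ) / 2) • (unitS₂ (sfStep Lc l) (smStep 3 Lc l) (T2RecOf 3 Lc (GcombSh Lc) (SpureCombOf tabs cE cVH cΛ) tabs.M cE₂ cB Tc tabs.vh₂S tabs.mixFF l) + ε • fun κ u κ' u' => sgnK (trK ((unitS₂ (sfStep Lc l) (smStep 3 Lc l) (T2RecOf 3 Lc (GcombSh Lc) (SpureCombOf tabs cE cVH cΛ) tabs.M cE₂ cB Tc tabs.vh₂S tabs.mixFF l)) κ u κ' u'))))))) (Cbd * θb ^ l) δbd)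
    (hθb0 : 0 ≤ θb) (hθb1 : θb < 1) (hδbd : 0 < δbd) :
    ∃ c ϑ δ : ℝ, 0 ≤ c ∧ 0 < ϑ ∧ ϑ < 1 ∧ 0 < δ ∧
      (∀ n, LocStencil₂
        ((((1 : ℝ) / 2) • (unitS₂ (sfStep Lc (n + 1)) (smStep 3 Lc (n + 1)) (T2RecOf 3 Lc (GcombSh Lc) (SpureCombOf tabs cE cVH cΛ) tabs.M cE₂ cB Tc tabs.vh₂S tabs.mixFF (n + 1)) + ε • fun κ u κ' u' => sgnK (trK ((unitS₂
          (sfStep Lc (n + 1)) (smStep 3 Lc (n + 1)) (T2RecOf 3 Lc (GcombSh Lc) (SpureCombOf tabs cE cVH cΛ) tabs.M cE₂ cB Tc tabs.vh₂S tabs.mixFF (n + 1))) κ u κ' u')))) -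
         (((1 : ℝ) / 2) • (unitS₂ (sfStep Lc n) (smStep 3 Lc n) (T2RecOf 3 Lc (GcombSh Lc) (SpureCombOf tabs cE cVH cΛ) tabs.M cE₂ cB Tc tabs.vh₂S tabs.mixFF n) + ε • fun κ u κ' u' => sgnK (trK ((unitS₂ (sfStep Lc n)
          (smStep 3 Lc n) (T2RecOf 3 Lc (GcombSh Lc) (SpureCombOf tabs cE cVH cΛ) tabs.M cE₂ cB Tc tabs.vh₂S tabs.mixFF n)) κ u κ' u'))))) (c * ϑ ^ n) δ) ∧
      (∀ k j, LocStencil₂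
        ((((1 : ℝ) / 2) • (unitS₂ (sfStep Lc (k + j)) (smStep 3 Lc (k + j)) (T2RecOf 3 Lc (GcombSh Lc) (SpureCombOf tabs cE cVH cΛ) tabs.M cE₂ cB Tc tabs.vh₂S tabs.mixFF (k + j)) + ε • fun κ u κ' u' => sgnK (trK ((unitS₂
          (sfStep Lc (k + j)) (smStep 3 Lc (k + j)) (T2RecOf 3 Lc (GcombSh Lc) (SpureCombOf tabs cE cVH cΛ) tabs.M cE₂ cB Tc tabs.vh₂S tabs.mixFF (k + j))) κ u κ' u')))) -
         (((1 : ℝ) / 2) • (unitS₂ (sfStep Lc k) (smStep 3 Lc k) (T2RecOf 3 Lc (GcombSh Lc) (SpureCombOf tabs cE cVH cΛ) tabs.M cE₂ cB Tc tabs.vh₂S tabs.mixFF k) + ε • fun κ u κ' u' => sgnK (trK ((unitS₂ (sfStep Lc k)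
          (smStep 3 Lc k) (T2RecOf 3 Lc (GcombSh Lc) (SpureCombOf tabs cE cVH cΛ) tabs.M cE₂ cB Tc tabs.vh₂S tabs.mixFF k)) κ u κ' u'))))) (c * (1 - ϑ)⁻¹ * ϑ ^ k) δ) := by
  have hLc1 : 1 ≤ Lc := le_trans (by norm_num) hLc
  have hpin : |cE₂| ≤ (Lc : ℝ) ^ (2 * (3 + 1)) := by
    rw [hpinEq, abs_of_nonneg (by positivity)]
  have hCy : 0 ≤ Cy := (hy 0).nonneg
  -- the one-step recursion of the `ε`-member in (R-HYB′) form: leaf-01 g72's `halfMember_succ_eq` re-based on road W3's undressed step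
  have hrec : ∀ j : ℕ,
      (((1 : ℝ) / 2) • (unitS₂ (sfStep Lc (j + 1)) (smStep 3 Lc (j + 1)) (T2RecOf 3 Lc (GcombSh Lc) (SpureCombOf tabs cE cVH cΛ) tabs.M cE₂ cB Tc tabs.vh₂S tabs.mixFF (j + 1)) + ε • fun κ u κ' u' => sgnK (trK ((unitS₂
        (sfStep Lc (j + 1)) (smStep 3 Lc (j + 1)) (T2RecOf 3 Lc (GcombSh Lc) (SpureCombOf tabs cE cVH cΛ) tabs.M cE₂ cB Tc tabs.vh₂S tabs.mixFF (j + 1))) κ u κ' u')))) =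
      lin4 (cE₂ * (Lc : ℝ) ^ (2 * (3 + 1))) (unitK (sfStep Lc j) (smStep 3 Lc j) (KInvStep (d := 3) Lc j)) Lc (((1 : ℝ) / 2) • (unitS₂ (sfStep Lc j) (smStep 3 Lc j) (T2RecOf 3 Lc (GcombSh Lc) (SpureCombOf tabs cE cVH cΛ) tabs.M cE₂ cB Tc tabs.vh₂S tabs.mixFF j) + ε • fun κ u κ' u' => sgnK (trK ((unitS₂ (sfStep Lc j) (smStep 3 Lc j) (T2RecOf 3 Lc (GcombSh Lc) (SpureCombOf tabs cE cVH cΛ) tabs.M cE₂ cB Tc tabs.vh₂S tabs.mixFF j)) κ u κ' u')))) +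
      (((1 : ℝ) / 2) • ((fun κ u κ' u' => (cE₂ * (Lc : ℝ) ^ (2 * (3 + 1))) • mmRead Lc (K3OfK (unitK (sfStep Lc j) (smStep 3 Lc j) (GcombSh (d := 3) Lc j)) Lc (unitS
        (sfStep Lc j) (smStep 3 Lc j) (SpureCombOf tabs cE cVH cΛ j)) (unitM (sfStep Lc j) (smStep 3 Lc j) (tabs.M j)) (W2SymOfK (unitK (sfStep Lc j) (smStep 3 Lc j)
        (GcombSh (d := 3) Lc j)) Lc (unitS (sfStep Lc j) (smStep 3 Lc j) (SpureCombOf tabs cE cVH cΛ j)) (unitM (sfStep Lc j) (smStep 3 Lc j) (tabs.M j)) 0 (unitM₂ (sfStep Lc j) (smStep 3 Lc j) (M2Of 3 Lc tabs.mixFF j))) κ u κ' u') + cB • tabs.vh₂S κ u κ' u') + ε • fun κ u κ' u' => sgnK (trK ((cE₂ * (Lc : ℝ) ^ (2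
        * (3 + 1))) • mmRead Lc (K3OfK (unitK (sfStep Lc j) (smStep 3 Lc j) (GcombSh (d := 3) Lc j)) Lc (unitS (sfStep Lc j) (smStep 3 Lc j) (SpureCombOf tabs cE cVH cΛ j)) (unitM (sfStep Lc j) (smStep 3 Lc j) (tabs.M j)) (W2SymOfK (unitK (sfStep Lc j) (smStep 3 Lc j) (GcombSh (d := 3) Lc j)) Lc (unitS (sfStep Lc j) (smStep 3 Lc j) (SpureCombOf tabs cE cVH cΛ j)) (unitM (sfStep Lc j) (smStep 3 Lc j) (tabs.M j)) 0 (unitM₂ (sfStep Lc j)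
        (smStep 3 Lc j) (M2Of 3 Lc tabs.mixFF j))) κ u κ' u') + cB • tabs.vh₂S κ u κ' u'))) + (lin4 (cE₂ * (Lc : ℝ) ^ (2 * (3 + 1))) (unitK (sfStep Lc j) (smStep 3 Lc j) (GcombSh (d := 3) Lc j)) Lc (((1 : ℝ) / 2) • (unitS₂ (sfStep Lc j) (smStep 3 Lc j) (T2RecOf 3 Lc (GcombSh Lc) (SpureCombOf tabs cE cVH cΛ) tabs.M cE₂ cB Tc tabs.vh₂S tabs.mixFF j) + ε • fun
        κ u κ' u' => sgnK (trK ((unitS₂ (sfStep Lc j) (smStep 3 Lc j) (T2RecOf 3 Lc (GcombSh Lc) (SpureCombOf tabs cE cVH cΛ) tabs.M cE₂ cB Tc tabs.vh₂S tabs.mixFF j)) κ u κ' u')))) - lin4 (cE₂ * (Lc : ℝ) ^ (2 * (3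
        + 1))) (unitK (sfStep Lc j) (smStep 3 Lc j) (KInvStep (d := 3) Lc j)) Lc (((1 : ℝ) / 2) • (unitS₂ (sfStep Lc j) (smStep 3 Lc j) (T2RecOf 3 Lc (GcombSh Lc) (SpureCombOf tabs cE cVH cΛ) tabs.M cE₂ cB Tc tabs.vh₂S tabs.mixFF j) + ε • fun κ u κ' u' => sgnK (trK ((unitS₂ (sfStep Lc j) (smStep 3 Lc j) (T2RecOf 3 Lc (GcombSh Lc) (SpureCombOf tabs cE cVH cΛ) tabs.M cE₂ cB Tc tabs.vh₂S tabs.mixFF j)) κ u κ' u')))))) := fun j => by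
    have h := halfMember_comb_succ_eq tabs cE cVH cΛ cE₂ cB Tc hBff hBmm ε j
    beta_reduce at h
    rw [h]
    abel
  -- leaf-01's engine: the DIFFERENCE tower unrolled through the SHIFTED undressed transport, on the class of bounded bi-tables
  have hdiff := diff_eq_transport_add_sum
    (A := fun j => lin4 (cE₂ * (Lc : ℝ) ^ (2 * (3 + 1))) (unitK (sfStep Lc j) (smStep 3 Lc j) (KInvStep (d := 3) Lc j)) Lc)
    (P := fun X : BiTab 3 => ∃ B : ℝ, ∀ κ u κ' u' x z a b, |X κ u κ' u' x z a b| ≤ B)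
    (x := fun n =>
      (((1 : ℝ) / 2) • (unitS₂ (sfStep Lc n) (smStep 3 Lc n) (T2RecOf 3 Lc (GcombSh Lc) (SpureCombOf tabs cE cVH cΛ) tabs.M cE₂ cB Tc tabs.vh₂S tabs.mixFF n) + ε • fun κ u κ' u' => sgnK (trK ((unitS₂ (sfStep Lc n)
        (smStep 3 Lc n) (T2RecOf 3 Lc (GcombSh Lc) (SpureCombOf tabs cE cVH cΛ) tabs.M cE₂ cB Tc tabs.vh₂S tabs.mixFF n)) κ u κ' u')))))
    (b := fun l =>
      (((1 : ℝ) / 2) • ((fun κ u κ' u' => (cE₂ * (Lc : ℝ) ^ (2 * (3 + 1))) • mmRead Lc (K3OfK (unitK (sfStep Lc l) (smStep 3 Lc l) (GcombSh (d := 3) Lc l)) Lc (unitS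
        (sfStep Lc l) (smStep 3 Lc l) (SpureCombOf tabs cE cVH cΛ l)) (unitM (sfStep Lc l) (smStep 3 Lc l) (tabs.M l)) (W2SymOfK (unitK (sfStep Lc l) (smStep 3 Lc l)
        (GcombSh (d := 3) Lc l)) Lc (unitS (sfStep Lc l) (smStep 3 Lc l) (SpureCombOf tabs cE cVH cΛ l)) (unitM (sfStep Lc l) (smStep 3 Lc l) (tabs.M l)) 0 (unitM₂ (sfStep Lc l) (smStep 3 Lc l) (M2Of 3 Lc tabs.mixFF l))) κ u κ' u') + cB • tabs.vh₂S κ u κ' u') + ε • fun κ u κ' u' => sgnK (trK ((cE₂ * (Lc : ℝ) ^ (2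
        * (3 + 1))) • mmRead Lc (K3OfK (unitK (sfStep Lc l) (smStep 3 Lc l) (GcombSh (d := 3) Lc l)) Lc (unitS (sfStep Lc l) (smStep 3 Lc l) (SpureCombOf tabs cE cVH cΛ l)) (unitM (sfStep Lc l) (smStep 3 Lc l) (tabs.M l)) (W2SymOfK (unitK (sfStep Lc l) (smStep 3 Lc l) (GcombSh (d := 3) Lc l)) Lc (unitS (sfStep Lc l) (smStep 3 Lc l) (SpureCombOf tabs cE cVH cΛ l)) (unitM (sfStep Lc l) (smStep 3 Lc l) (tabs.M l)) 0 (unitM₂ (sfStep Lc l)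
        (smStep 3 Lc l) (M2Of 3 Lc tabs.mixFF l))) κ u κ' u') + cB • tabs.vh₂S κ u κ' u'))) + (lin4 (cE₂ * (Lc : ℝ) ^ (2 * (3 + 1))) (unitK (sfStep Lc l) (smStep 3 Lc l) (GcombSh (d := 3) Lc l)) Lc (((1 : ℝ) / 2) • (unitS₂ (sfStep Lc l) (smStep 3 Lc l) (T2RecOf 3 Lc (GcombSh Lc) (SpureCombOf tabs cE cVH cΛ) tabs.M cE₂ cB Tc tabs.vh₂S tabs.mixFF l) + ε • fun
        κ u κ' u' => sgnK (trK ((unitS₂ (sfStep Lc l) (smStep 3 Lc l) (T2RecOf 3 Lc (GcombSh Lc) (SpureCombOf tabs cE cVH cΛ) tabs.M cE₂ cB Tc tabs.vh₂S tabs.mixFF l)) κ u κ' u')))) - lin4 (cE₂ * (Lc : ℝ) ^ (2 * (3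
        + 1))) (unitK (sfStep Lc l) (smStep 3 Lc l) (KInvStep (d := 3) Lc l)) Lc (((1 : ℝ) / 2) • (unitS₂ (sfStep Lc l) (smStep 3 Lc l) (T2RecOf 3 Lc (GcombSh Lc) (SpureCombOf tabs cE cVH cΛ) tabs.M cE₂ cB Tc tabs.vh₂S tabs.mixFF l) + ε • fun κ u κ' u' => sgnK (trK ((unitS₂ (sfStep Lc l) (smStep 3 Lc l) (T2RecOf 3 Lc (GcombSh Lc) (SpureCombOf tabs cE cVH cΛ) tabs.M cE₂ cB Tc tabs.vh₂S tabs.mixFF l)) κ u κ' u')))))))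
    bdd₄_zero (fun _ _ => bdd₄_add) (fun _ _ => bdd₄_sub) (lin4_bdd₄ cE₂) (lin4_add_bdd₄ cE₂) (bdd₄_of_locStencil₂ (hy 0) hδy.le)
    (fun j => bdd₄_of_locStencil₂ (hb j) hδb.le) hrec
  -- road P1's K-slot; the member's joint covariance (`T2DevCovariance` ⨾ PART 1 §1)
  obtain ⟨CK, δK, cK, θK, hδK, hθK0, hθK1, hK, hKall⟩ := convCKWall_holds (Lc := Lc) hLc
  have hCK : 0 ≤ CK := (hK 0).nonneg (Sum.inl 0)
  have hycov := fun (n : ℕ) (κ : Fin (3 + 1)) (u : Fin (3 + 1) → ℤ) (κ' : Fin (3 + 1)) (u' t : Fin (3 + 1) → ℤ) =>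
    translate_halfTable (fun κ u κ' u' t => unitS₂_T2RecOf_comb_translate tabs cE cVH cΛ cE₂ cB Tc n κ u κ' u' t) ε κ u κ' u' t
  -- the forcing's RATE row (K-Cauchy × «T2Shape^ε» + the relative source's drift) and its `ZfreeSym` row (NO charge hypothesis + `hZ` at `m, m+1`)
  obtain ⟨Cf, θf, δf, hCf, hθf0, hθf1, hδf, hf⟩ := exists_forcing_rate (d := 3) hLc1 (cE₂ * (Lc : ℝ) ^ (2 * (3 + 1))) _
    (fun l =>
      (((1 : ℝ) / 2) • ((fun κ u κ' u' => (cE₂ * (Lc : ℝ) ^ (2 * (3 + 1))) • mmRead Lc (K3OfK (unitK (sfStep Lc l) (smStep 3 Lc l) (GcombSh (d := 3) Lc l)) Lc (unitS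
        (sfStep Lc l) (smStep 3 Lc l) (SpureCombOf tabs cE cVH cΛ l)) (unitM (sfStep Lc l) (smStep 3 Lc l) (tabs.M l)) (W2SymOfK (unitK (sfStep Lc l) (smStep 3 Lc l)
        (GcombSh (d := 3) Lc l)) Lc (unitS (sfStep Lc l) (smStep 3 Lc l) (SpureCombOf tabs cE cVH cΛ l)) (unitM (sfStep Lc l) (smStep 3 Lc l) (tabs.M l)) 0 (unitM₂ (sfStep Lc l) (smStep 3 Lc l) (M2Of 3 Lc tabs.mixFF l))) κ u κ' u') + cB • tabs.vh₂S κ u κ' u') + ε • fun κ u κ' u' => sgnK (trK ((cE₂ * (Lc : ℝ) ^ (2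
        * (3 + 1))) • mmRead Lc (K3OfK (unitK (sfStep Lc l) (smStep 3 Lc l) (GcombSh (d := 3) Lc l)) Lc (unitS (sfStep Lc l) (smStep 3 Lc l) (SpureCombOf tabs cE cVH cΛ l)) (unitM (sfStep Lc l) (smStep 3 Lc l) (tabs.M l)) (W2SymOfK (unitK (sfStep Lc l) (smStep 3 Lc l) (GcombSh (d := 3) Lc l)) Lc (unitS (sfStep Lc l) (smStep 3 Lc l) (SpureCombOf tabs cE cVH cΛ l)) (unitM (sfStep Lc l) (smStep 3 Lc l) (tabs.M l)) 0 (unitM₂ (sfStep Lc l)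
        (smStep 3 Lc l) (M2Of 3 Lc tabs.mixFF l))) κ u κ' u') + cB • tabs.vh₂S κ u κ' u'))) + (lin4 (cE₂ * (Lc : ℝ) ^ (2 * (3 + 1))) (unitK (sfStep Lc l) (smStep 3 Lc l) (GcombSh (d := 3) Lc l)) Lc (((1 : ℝ) / 2) • (unitS₂ (sfStep Lc l) (smStep 3 Lc l) (T2RecOf 3 Lc (GcombSh Lc) (SpureCombOf tabs cE cVH cΛ) tabs.M cE₂ cB Tc tabs.vh₂S tabs.mixFF l) + ε • fun
        κ u κ' u' => sgnK (trK ((unitS₂ (sfStep Lc l) (smStep 3 Lc l) (T2RecOf 3 Lc (GcombSh Lc) (SpureCombOf tabs cE cVH cΛ) tabs.M cE₂ cB Tc tabs.vh₂S tabs.mixFF l)) κ u κ' u')))) - lin4 (cE₂ * (Lc : ℝ) ^ (2 * (3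
        + 1))) (unitK (sfStep Lc l) (smStep 3 Lc l) (KInvStep (d := 3) Lc l)) Lc (((1 : ℝ) / 2) • (unitS₂ (sfStep Lc l) (smStep 3 Lc l) (T2RecOf 3 Lc (GcombSh Lc) (SpureCombOf tabs cE cVH cΛ) tabs.M cE₂ cB Tc tabs.vh₂S tabs.mixFF l) + ε • fun κ u κ' u' => sgnK (trK ((unitS₂ (sfStep Lc l) (smStep 3 Lc l) (T2RecOf 3 Lc (GcombSh Lc) (SpureCombOf tabs cE cVH cΛ) tabs.M cE₂ cB Tc tabs.vh₂S tabs.mixFF l)) κ u κ' u')))))))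
    hK hKall hδK hθK0 hθK1 hy hδy hbd hθb0 hθb1 hδbd
  have hZf := fun m : ℕ => zfreeSym_forcing (d := 3) hLc1 (m + 1) m (cE₂ * (Lc : ℝ) ^ (2 * (3 + 1))) (hK (m + 1)) (hK m) hCK hδK (hy m) hδy (hycov m)
    (hb m) (hb (m + 1)) hδb (hZ m) (hZ (m + 1))
  -- the first difference: shape from «T2Shape^ε»; `ZfreeSym` from §1 at the exact pin and `hZ 0`
  have hδin : 0 < min δf δy := lt_min hδf hδy
  have hZ0 := zfreeSym_succ_sub (d := 3) hLc1 0 (pinConst_three hLc1 hpinEq) (hy 0) hδy (hycov 0) (hb 0) hδb (hZ 0) (hrec 0)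
  -- road W3's END #2 socket certificate at the shifted undressed transport
  obtain ⟨c, ϑ, δT, hc, hϑ0, hϑ1, hδT, -, hD⟩ := rate_three_of_rows_F3b hLc hK hδK cE₂
    (fun n =>
      (((1 : ℝ) / 2) • (unitS₂ (sfStep Lc (n + 1)) (smStep 3 Lc (n + 1)) (T2RecOf 3 Lc (GcombSh Lc) (SpureCombOf tabs cE cVH cΛ) tabs.M cE₂ cB Tc tabs.vh₂S tabs.mixFF (n + 1)) + ε • fun κ u κ' u' => sgnK (trK ((unitS₂
        (sfStep Lc (n + 1)) (smStep 3 Lc (n + 1)) (T2RecOf 3 Lc (GcombSh Lc) (SpureCombOf tabs cE cVH cΛ) tabs.M cE₂ cB Tc tabs.vh₂S tabs.mixFF (n + 1))) κ u κ' u')))) -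
      (((1 : ℝ) / 2) • (unitS₂ (sfStep Lc n) (smStep 3 Lc n) (T2RecOf 3 Lc (GcombSh Lc) (SpureCombOf tabs cE cVH cΛ) tabs.M cE₂ cB Tc tabs.vh₂S tabs.mixFF n) + ε • fun κ u κ' u' => sgnK (trK ((unitS₂ (sfStep Lc n)
        (smStep 3 Lc n) (T2RecOf 3 Lc (GcombSh Lc) (SpureCombOf tabs cE cVH cΛ) tabs.M cE₂ cB Tc tabs.vh₂S tabs.mixFF n)) κ u κ' u')))))
    _ (fun _ => (0 : ℝ)) hδin hθf0 hθf1 hpin (fun n => hdiff n)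
    (fun m => ⟨(hf m).mono (min_le_left _ _), mul_nonneg hCf (pow_nonneg hθf0 m)⟩) hZf
    ⟨(locStencil₂_sub (hy (0 + 1)) (hy 0)).mono (min_le_right _ _), add_nonneg hCy (mul_nonneg (abs_nonneg _) hCy)⟩ hZ0
  refine ⟨c, ϑ, δT, hc, hϑ0, hϑ1, hδT, hD, fun k j => ?_⟩
  exact cauchy_of_rate (fun n =>
      (((1 : ℝ) / 2) • (unitS₂ (sfStep Lc n) (smStep 3 Lc n) (T2RecOf 3 Lc (GcombSh Lc) (SpureCombOf tabs cE cVH cΛ) tabs.M cE₂ cB Tc tabs.vh₂S tabs.mixFF n) + ε • fun κ u κ' u' => sgnK (trK ((unitS₂ (sfStep Lc n)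
        (smStep 3 Lc n) (T2RecOf 3 Lc (GcombSh Lc) (SpureCombOf tabs cE cVH cΛ) tabs.M cE₂ cB Tc tabs.vh₂S tabs.mixFF n)) κ u κ' u'))))) hc hϑ0.le hϑ1 hD k j

end Three

end Summit.QuantumFields.BalabanUV.Beta.GAN24.CombT2DriftEvenEnd

end
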